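import Summits.BirchSwinnertonDyer.BirchSwinnertonDyer.Theorems.AdditiveKolyvaginRoadAdmissibleJump
import Summits.BirchSwinnertonDyer.BirchSwinnertonDyer.Theorems.AdditiveKolyvaginRoadOnePlaceLagrangian
import HarnessLib

/-!
# Route `AdditiveKolyvaginRoad`, crux `LevelKolyvaginSystemsAdditive` (item stmt-BirchSwinnertonDyer-21396, KS′):
# the Poitou–Tate JUMP of the canonical LEVEL-`n` structure AT ONE RELAXED PLACE ABOVE `p`
# (cell `pub/bsd-wall`, width seat `bsd-wall-akr-p2x-w2` g9; `--supports stmt-BirchSwinnertonDyer-21396`, helper; E-side brick for the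
# support lemma S-vis `VisibleEvenCoreLevel` of the crux-ideate card `Cruxes/LevelKolyvaginSystemsAdditive/Ideas/pointwise-klingen-seed.md`)

WHAT. `exists_levelRelaxed_notMem_torsionLocalKer_above_p`: for `K` imaginary quadratic, the named Poitou–Tate fact
`poitouTate_selmerStructure_duality K`, a finite set `n` of Bertolini–Darmon admissible primes and a place `w ∣ p`: there is a class
`x ∈ H¹(K, E[p])` satisfying E's Kummer condition at the infinite places and at the finite places `v ≠ w` above no prime of `n`, the
TORIC condition above the primes of `n`, NO condition at `w`, and `loc_w x ≠ 0`. I.e. the canonical level-`n` structure RELAXED at `w`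
is strictly bigger than the same structure STRICT at `w`: by the Lagrangian count `ZhangSupply.relIndex_sq_eq_of_selfdual` (koly3b
part XI) the square of the index is `#H¹(K_w, E[p]) = (#E(K_w)[p] · #(𝓞_w ⧸ p))²` (Tate's local Euler–Poincaré characteristic,
PROVED in the tree: `localEulerPoincareCharacteristic_holds`), and `#(𝓞_w ⧸ p) > 1` at `w ∣ p`
(`one_lt_natCard_quotient_span_of_mem`, akr-p2x-w3 g3).

This is akr-p2x g0's `exists_relaxed_notMem_torsionLocalKer_of_admQ` (`…AdmissibleJump.lean`: the special place an
ADMISSIBLE `w`) with the special place moved ABOVE `p` — construction of the two model structures and of every Lagrangian clause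
VERBATIM, only the final count changes (`#H¹ ≥ p²` at an admissible place ↦ the Euler–Poincaré count at `w ∣ p`); and it is
akr-p2x-w3 g3's `exists_mem_kummerOutside_single_notMem_torsionLocalKer_of_dvd` (`…OnePlaceLagrangian.lean`: the same jump for the
PLAIN Kummer structure, level `∅`) with toric conditions above a non-empty level allowed.

WHY. The support lemma S-vis of card `pointwise-klingen-seed` (a 𝔭-VISIBLE even core vertex: `Ideas/pointwise-klingen-seed.md`, First
lemma `VisibleEvenCoreLevel`) is reached from a ZERO vertex `m` (`Sel_m^± = 0`, `#m` odd, by the landed rank lowering A1) by ONE raising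
prime `q` chosen by Čebotarev on a class `t` of exactly this kind — Kummer off `m ∪ {w}`, toric on `m`, detected at `w ∣ p`: Tate
reciprocity for the pair (new class at `m ∪ {q}`, `t`) then forces the new class to be detected above `p`. This file supplies `t`.

HONEST FRAMING: one theorem; 0 definitions, 0 named facts, 0 `sorry`; CONDITIONAL on the named PT fact (the route's DUAL input, as
every (R)/(R′)/jump file of this crux); closes nothing. BSD is not proved by any of this; KS′/KPA′ stay OPEN at `p² ∣ N`.

References: [cite: WZhang2014, Lemma 5.3, Prop. 5.4] [cite: BertoliniDarmon2005, §2.2–§2.3, Lemma 2.6]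
[cite: MilneADT2006, Ch. I, Cor. 2.3, Thm. 2.8, Thm. 4.10] [cite: MazurRubin2004, Prop. 4.5.8, Lemma 4.1.7]
[cite: Howard2004HeegnerKolyvagin, Thm. 2.1.11].
-/

-- single-conjunct summit: `Summit.BirchSwinnertonDyer.BirchSwinnertonDyer.…` repeats the name by design
set_option linter.dupNamespace false

noncomputable section

open scoped Classical NumberField
open Function NumberField IsDedekindDomain Field WeierstrassCurve
open Literature.NumberTheory.EllipticCurves Literature.NumberTheory.EllipticCurves.ModularForms
open Literature.NumberTheory.GaloisRepresentations Literature.NumberTheory.GaloisRepresentations.DiscreteGaloisModule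
  Literature.NumberTheory.GaloisCohomology
open Summit.BirchSwinnertonDyer.Rank1Residual.X11b.FiniteDuality
open Summit.BirchSwinnertonDyer.Rank1Residual.X11b.Relaxation
open Summit.BirchSwinnertonDyer.Rank1Residual.X11b.LocBridge
open Summit.BirchSwinnertonDyer.Rank1Residual.X11b
open Summit.BirchSwinnertonDyer.Rank1Residual.GaloisImage
open Summit.BirchSwinnertonDyer.Rank1Residual.X11b.Three.Koly.ZhangSupply
open Summit.BirchSwinnertonDyer.Rank1Residual.X11b.Three.Koly.Method2

namespace Summit.BirchSwinnertonDyer.BirchSwinnertonDyer.Theorems.AdditiveKoly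

variable (W : WeierstrassCurve ℚ) (K : Type) [Field K] [NumberField K] (p : ℕ) [W.IsElliptic] [W.IsGloballyMinimal]
  [Fact p.Prime]
  -- cup products need the compactness of the local absolute Galois groups (binder, discharged by
  -- `absoluteGaloisGroup_compactSpace` at the call site)
  [∀ v : Place K, CompactSpace (absoluteGaloisGroup (Place.Completion v))]

/-- **The jump of the canonical level-`n` structure at one relaxed place ABOVE `p`.** `K` imaginary quadratic, the
named PT fact, `n` a finite set of BD-admissible primes, `w` a place of `K` above `p`: some class of `H¹(K, E[p])` is Kummer at `∞`
and at the finite `v ≠ w` above no prime of `n`, toric above the primes of `n`, and NOT locally trivial at `w`. Proof: the model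
structures «strict ∕ relaxed at `w`» are equal and LAGRANGIAN off `w` (Kummer: X11b + Tate's local Euler characteristic; toric:
akr-p1's isotropy + count), so `[relaxed : strict]² = #H¹(K_w, E[p]) = (#E(K_w)[p] · #(𝓞_w ⧸ p))² > 1`
(`relIndex_sq_eq_of_selfdual`, `natCard_galoisCohomology_one_torsion_adicCompletion_eq_sq`,
`one_lt_natCard_quotient_span_of_mem`), and a relaxed class outside the strict group has `loc_w ≠ 0`.
[cite: WZhang2014, Lemma 5.3] [cite: MilneADT2006, Ch. I, Thm. 2.8, Thm. 4.10] [cite: MazurRubin2004, Lemma 4.1.7] -/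
theorem exists_levelRelaxed_notMem_torsionLocalKer_above_p (hK : IsImaginaryQuadratic K)
    (hPT : poitouTate_selmerStructure_duality K) :
    ∀ (n : Finset (AdmQ W K p)) (w : HeightOneSpectrum (𝓞 K)), ((p : ℕ) : 𝓞 K) ∈ w.asIdeal →
      ∃ x : Vp W K p,
        (∀ u : InfinitePlace K, x ∈ selmerLocalKer (W.baseChange K) u.Completion ((p ^ 1 : ℕ) : ℤ)) ∧
        (∀ v : HeightOneSpectrum (𝓞 K), v ≠ w →
          ((∀ q ∈ n, ((q : ℕ) : 𝓞 K) ∉ v.asIdeal) →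
            x ∈ selmerLocalKer (W.baseChange K) (v.adicCompletion K) ((p ^ 1 : ℕ) : ℤ)) ∧
          (∀ q ∈ n, ((q : ℕ) : 𝓞 K) ∈ v.asIdeal →
            x ∈ toricLocalKer (W.baseChange K) (v.adicCompletion K) ((p ^ 1 : ℕ) : ℤ))) ∧
        x ∉ (W.baseChange K).torsionLocalKer (w.adicCompletion K) ((p ^ 1 : ℕ) : ℤ) := by
  intro n w hpw
  have hp : p.Prime := Fact.out
  haveI : NeZero (p ^ 1 : ℕ) := ⟨pow_ne_zero 1 hp.ne_zero⟩
  haveI : IsTotallyComplex K := hK.2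
  haveI : CompactSpace (absoluteGaloisGroup K) := absoluteGaloisGroup_compactSpace K
  haveI : Finite (Literature.NumberTheory.GaloisRepresentations.DiscreteGaloisModule.MuCarrier K (p ^ 1)) :=
    Literature.NumberTheory.EllipticCurves.finite_muCarrier (p ^ 1) K
  haveI : Finite (geomTorsion (W.baseChange K) ((p ^ 1 : ℕ) : ℤ)) :=
    finite_geomTorsion_of_neZero (W.baseChange K) (p ^ 1)
  have hK2 : Module.finrank ℚ K = 2 := hK.1
  have hKc : ∀ u : InfinitePlace K, u.IsComplex := fun u ↦ IsTotallyComplex.isComplex u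
  -- a Weil pairing on `E[p]` and the Poitou–Tate family at level `p`
  have h2p : 2 ≤ p ^ 1 := by rw [pow_one]; exact hp.two_le
  obtain ⟨e, hμ, hadd₁, hadd₂, halt, hnondeg, hgal⟩ :=
    exists_weilPairing_holds (W.baseChange K) (p ^ 1) h2p (by exact_mod_cast pow_ne_zero 1 hp.ne_zero)
  obtain ⟨inv, hperf, hsum, -, hcompl⟩ := hPT (p ^ 1)
  have hinj : ∀ v : HeightOneSpectrum (𝓞 K), Injective (inv (Sum.inr v)) := fun v ↦ (hperf v).1.1
  have hM : ∀ m : geomTorsion (W.baseChange K) ((p ^ 1 : ℕ) : ℤ), (p ^ 1 : ℕ) • m = 0 := fun m ↦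
    AddSubgroup.torsionBy.nsmul m
  -- `w` lies above no prime of the level
  have hwn : ∀ q ∈ n, ((q : ℕ) : 𝓞 K) ∉ w.asIdeal := fun q _ hqw ↦ by
    -- the place of an admissible prime is not above `p`
    have h := (hasGoodReductionAt_of_isAdmissiblePrime W K q.2 w hqw).2
    rw [Int.cast_natCast] at h
    exact h hpw
  -- the exceptional finite set `T'` of finite places: above `p`, bad, `w`, above the level
  have hp0 : (Ideal.span {((p : ℕ) : 𝓞 K)} : Ideal (𝓞 K)) ≠ 0 := by
    rw [Ne, Ideal.zero_eq_bot, Ideal.span_singleton_eq_bot]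
    exact_mod_cast hp.ne_zero
  have hpfin : {v : HeightOneSpectrum (𝓞 K) | ((p : ℕ) : 𝓞 K) ∈ v.asIdeal}.Finite :=
    (Ideal.finite_factors hp0).subset fun v hv ↦ (Ideal.dvd_span_singleton).mpr hv
  have hbadfin : {v : HeightOneSpectrum (𝓞 K) | ¬ (W.baseChange K).HasGoodReductionAt v}.Finite := by
    have h := (W.baseChange K).eventually_hasGoodReductionAt
    rwa [Filter.eventually_cofinite] at h
  have hnfin : {v : HeightOneSpectrum (𝓞 K) | ∃ q ∈ n, ((q : ℕ) : 𝓞 K) ∈ v.asIdeal}.Finite := by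
    have hq : ∀ q : AdmQ W K p, {v : HeightOneSpectrum (𝓞 K) | ((q : ℕ) : 𝓞 K) ∈ v.asIdeal}.Finite := by
      intro q
      have hq0 : (Ideal.span {((q : ℕ) : 𝓞 K)} : Ideal (𝓞 K)) ≠ 0 := by
        rw [Ne, Ideal.zero_eq_bot, Ideal.span_singleton_eq_bot]
        exact_mod_cast q.2.1.ne_zero
      exact (Ideal.finite_factors hq0).subset fun v hv ↦ (Ideal.dvd_span_singleton).mpr hv
    refine ((n : Set (AdmQ W K p)).toFinite.biUnion fun q _ ↦ hq q).subset ?_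
    intro v hv
    obtain ⟨q, hqn, hqv⟩ := hv
    exact Set.mem_biUnion (Finset.mem_coe.mpr hqn) hqv
  set T' : Finset (HeightOneSpectrum (𝓞 K)) :=
    hpfin.toFinset ∪ hbadfin.toFinset ∪ {w} ∪ hnfin.toFinset with hT'
  have hpT' : ∀ v : HeightOneSpectrum (𝓞 K), ((p : ℕ) : 𝓞 K) ∈ v.asIdeal → v ∈ T' := fun v hv ↦ by
    apply Finset.mem_union_left; apply Finset.mem_union_left; apply Finset.mem_union_left
    exact hpfin.mem_toFinset.mpr hv
  have hbadT' : ∀ v : HeightOneSpectrum (𝓞 K), ¬ (W.baseChange K).HasGoodReductionAt v → v ∈ T' := fun v hv ↦ by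
    apply Finset.mem_union_left; apply Finset.mem_union_left; apply Finset.mem_union_right
    exact hbadfin.mem_toFinset.mpr hv
  have hwT' : w ∈ T' := by
    apply Finset.mem_union_left; apply Finset.mem_union_right
    exact Finset.mem_singleton_self _
  have hnT' : ∀ v : HeightOneSpectrum (𝓞 K), ∀ q ∈ n, ((q : ℕ) : 𝓞 K) ∈ v.asIdeal → v ∈ T' := fun v q hq hqv ↦ by
    apply Finset.mem_union_right
    exact hnfin.mem_toFinset.mpr ⟨q, hq, hqv⟩
  have houtp : ∀ v : HeightOneSpectrum (𝓞 K), v ∉ T' → ((p : ℕ) : 𝓞 K) ∉ v.asIdeal := fun v hv h ↦ hv (hpT' v h)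
  have houtgood : ∀ v : HeightOneSpectrum (𝓞 K), v ∉ T' → (W.baseChange K).HasGoodReductionAt v := fun v hv ↦ by
    by_contra h
    exact hv (hbadT' v h)
  have houtw : ∀ v : HeightOneSpectrum (𝓞 K), v ∉ T' → v ≠ w := fun v hv h ↦ hv (h ▸ hwT')
  have houtn : ∀ v : HeightOneSpectrum (𝓞 K), v ∉ T' → ¬ ∃ q ∈ n, ((q : ℕ) : 𝓞 K) ∈ v.asIdeal :=
    fun v hv ⟨q, hq, hqv⟩ ↦ hv (hnT' v q hq hqv)
  -- the two structures: `s = true` relaxed at `w`, `s = false` strict at `w`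
  set 𝓚 : SelmerStructure ((W.baseChange K).torsionGaloisModule ((p ^ 1 : ℕ) : ℤ)) :=
    (W.baseChange K).kummerSelmerStructure ((p ^ 1 : ℕ) : ℤ) with h𝓚
  let Ltor : (v : HeightOneSpectrum (𝓞 K)) →
      AddSubgroup (galoisCohomology (((W.baseChange K).torsionGaloisModule ((p ^ 1 : ℕ) : ℤ)).toLocal (Sum.inr v)) 1) :=
    fun v ↦ toricLocalCondition (W.baseChange K) (v.adicCompletion K) ((p ^ 1 : ℕ) : ℤ)
  let str : Bool → SelmerStructure ((W.baseChange K).torsionGaloisModule ((p ^ 1 : ℕ) : ℤ)) := fun s v ↦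
    match v with
    | Sum.inl u => 𝓚 (Sum.inl u)
    | Sum.inr v =>
      if v = w then (bif s then ⊤ else ⊥)
      else if (∃ q ∈ n, ((q : ℕ) : 𝓞 K) ∈ v.asIdeal) then Ltor v
      else 𝓚 (Sum.inr v)
  have hstr_inl : ∀ s (u : InfinitePlace K), str s (Sum.inl u) = 𝓚 (Sum.inl u) := fun _ _ ↦ rfl
  have hstr_inr : ∀ s (v : HeightOneSpectrum (𝓞 K)), str s (Sum.inr v) =
      if v = w then (bif s then ⊤ else ⊥)
      else if (∃ q ∈ n, ((q : ℕ) : 𝓞 K) ∈ v.asIdeal) then Ltor v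
      else 𝓚 (Sum.inr v) := fun _ _ ↦ rfl
  have hstr_w : ∀ s, str s (Sum.inr w) = (bif s then ⊤ else ⊥) := fun s ↦ by
    rw [hstr_inr, if_pos rfl]
  have hstr_n : ∀ s (v : HeightOneSpectrum (𝓞 K)), v ≠ w →
      ∀ q ∈ n, ((q : ℕ) : 𝓞 K) ∈ v.asIdeal → str s (Sum.inr v) = Ltor v := fun s v hv q hq hqv ↦ by
    rw [hstr_inr, if_neg hv, if_pos ⟨q, hq, hqv⟩]
  have hstr_K : ∀ s (v : HeightOneSpectrum (𝓞 K)), v ≠ w →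
      (¬ ∃ q ∈ n, ((q : ℕ) : 𝓞 K) ∈ v.asIdeal) → str s (Sum.inr v) = 𝓚 (Sum.inr v) := fun s v hv hvn ↦ by
    rw [hstr_inr, if_neg hv, if_neg hvn]
  have hstr_out : ∀ s (v : HeightOneSpectrum (𝓞 K)), v ∉ T' → str s (Sum.inr v) = 𝓚 (Sum.inr v) :=
    fun s v hv ↦ hstr_K s v (houtw v hv) (houtn v hv)
  -- the side conditions
  have hS : ∀ v : HeightOneSpectrum (𝓞 K), v ∉ T' → (((p ^ 1 : ℕ) : ℕ) : 𝓞 K) ∉ v.asIdeal ∧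
      GaloisRep.IsUnramifiedAt v ((W.baseChange K).torsionGaloisModule (p ^ 1 : ℕ)) := by
    intro v hv
    have h3 : ((p ^ 1 : ℕ) : 𝓞 K) ∉ v.asIdeal := by
      rw [pow_one]
      exact houtp v hv
    refine ⟨h3, ?_⟩
    exact AcSelmer.isUnramifiedAt_torsionGaloisModule (W.baseChange K) (houtgood v hv)
      (n := ((p ^ 1 : ℕ) : ℤ)) (by rw [Int.cast_natCast]; exact h3)
  have hunr : ∀ s, (str s).IsUnramifiedOutside (finSupport T') := by
    intro s
    refine ⟨fun u ↦ inl_mem_finSupport T' u, fun v hv ↦ ?_⟩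
    rw [inr_mem_finSupport_iff] at hv
    rw [hstr_out s v hv, h𝓚]
    exact KummerPT.kummerSelmerStructure_inr_eq_unramifiedSubgroup (W.baseChange K) p 1
      (by exact_mod_cast houtp v hv) (houtgood v hv)
  have heq : ∀ v : Place K, v ≠ Sum.inr w → str false v = str true v := by
    intro v hv
    rcases v with u | v
    · rfl
    · have hv' : v ≠ w := fun h ↦ hv (h ▸ rfl)
      rw [hstr_inr, hstr_inr, if_neg hv', if_neg hv']
  have hstrict : str false (Sum.inr w) = ⊥ := hstr_w false
  have hrelax : str true (Sum.inr w) = ⊤ := hstr_w true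
  -- finiteness: `H¹_{str false} ⊆ H¹_{𝓚 relaxed on S(T')} = kummerOutside`
  have hfin : Finite (str false).selmerGroup := by
    have hle : (str false).selmerGroup ≤
        (KummerPT.kummerRelaxed (W.baseChange K) (p ^ 1) (finSupport T')).selmerGroup := by
      intro x hx
      rw [SelmerStructure.mem_selmerGroup_iff] at hx ⊢
      intro v
      rcases v with u | v
      · rw [KummerPT.kummerRelaxed_of_mem _ _ _ (inl_mem_finSupport T' u)]
        exact AddSubgroup.mem_top _
      · by_cases hvT : v ∈ T'
        · rw [KummerPT.kummerRelaxed_of_mem _ _ _ ((inr_mem_finSupport_iff T' v).mpr hvT)]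
          exact AddSubgroup.mem_top _
        · rw [KummerPT.kummerRelaxed_of_not_mem _ _ _ (fun h ↦ hvT ((inr_mem_finSupport_iff T' v).mp h))]
          have h := hx (Sum.inr v)
          rw [hstr_out false v hvT, h𝓚] at h
          exact h
    haveI : Finite (KummerPT.kummerRelaxed (W.baseChange K) (p ^ 1) (finSupport T')).selmerGroup := by
      rw [KummerPT.selmerGroup_kummerRelaxed]
      exact SelmerLevelBound.finite_kummerOutside (W.baseChange K) (p ^ 1) (finSupport T')
    exact Finite.of_injective (AddSubgroup.inclusion hle) (AddSubgroup.inclusion_injective hle)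
  -- the Lagrangian property off `w`
  have hp1 : IsPrimePow (p ^ 1 : ℕ) := hp.isPrimePow.pow one_ne_zero
  have hEP : ∀ v : HeightOneSpectrum (𝓞 K), localEulerPoincareCharacteristic (v.adicCompletion K) := fun v ↦ by
    haveI : CharZero (v.adicCompletion K) := charZero_of_injective_algebraMap (algebraMap K _).injective
    exact localEulerPoincareCharacteristic_holds (v.adicCompletion K)
  have hmaxK : ∀ v : Place K, annRight (invWeilPairing (W.baseChange K) (p ^ 1 : ℕ) e hμ hadd₁ hadd₂ hgal inv v)
      (𝓚 v) = 𝓚 v := fun v ↦ by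
    rw [h𝓚]
    exact KummerDuality.annRight_invWeilPairing_kummerSelmerStructure_eq (W.baseChange K) (p ^ 1) e hμ hadd₁ hadd₂
      hgal halt hnondeg inv hKc hp1 hperf hEP v
  have hmax : ∀ v : Place K, v ≠ Sum.inr w →
      annRight (invWeilPairing (W.baseChange K) (p ^ 1 : ℕ) e hμ hadd₁ hadd₂ hgal inv v) (str false v) =
        str false v := by
    intro v hv
    rcases v with u | v
    · rw [hstr_inl false u]
      exact hmaxK (Sum.inl u)
    · have hv' : v ≠ w := fun h ↦ hv (h ▸ rfl)
      by_cases hvn : ∃ q ∈ n, ((q : ℕ) : 𝓞 K) ∈ v.asIdeal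
      · obtain ⟨q, hq, hqv⟩ := hvn
        rw [hstr_n false v hv' q hq hqv]
        exact annRight_invWeilPairing_eq_of_isotropic_of_card_le (W.baseChange K) (p ^ 1) e hμ hadd₁ hadd₂ hgal
          hnondeg inv v (hinj v) (Ltor v)
          (fun a ha b hb ↦ htorIso_toricLocalCondition W K p hK2 q v hqv e hμ hadd₁ hadd₂ halt hgal a ha b hb)
          (natCard_galoisCohomology_one_le_mul_natCard_toricLocalCondition W K p hK2 q v hqv)
      · rw [hstr_K false v hv' hvn]
        exact hmaxK (Sum.inr v)
  -- numeric self-duality `#H¹_{𝓕*} = #H¹_𝓖`, `#H¹_{𝓖*} = #H¹_𝓕` (koly3b part XII §1–§2, verbatim)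
  have hFd : Nat.card (inv.dualSelmerStructure ((W.baseChange K).torsionGaloisModule ((p ^ 1 : ℕ) : ℤ))
      (str false)).selmerGroup = Nat.card (str true).selmerGroup := by
    refine card_dualSelmerGroup_eq_of_weilTransport (W.baseChange K) (p ^ 1) e hμ hadd₁ hadd₂ hgal hnondeg inv
      (str false) (str true) (fun v b hb ↦ ?_) (fun v a ha ↦ ?_)
    · by_cases hv : v = Sum.inr w
      · subst hv; rw [hrelax]; exact AddSubgroup.mem_top _
      · rw [← heq v hv]
        exact map_weilDualInv_mem_of_mem_dual_of_lagrangian (W.baseChange K) (p ^ 1) e hμ hadd₁ hadd₂ hgal hnondeg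
          inv v _ (hmax v hv) hb
    · by_cases hv : v = Sum.inr w
      · subst hv
        rw [hstrict, dualLocalCondition_bot_eq_top]
        exact AddSubgroup.mem_top _
      · rw [← heq v hv] at ha
        exact map_weilDual_mem_dual_of_lagrangian (W.baseChange K) (p ^ 1) e hμ hadd₁ hadd₂ hgal inv v _
          (hmax v hv) ha
  have hGd : Nat.card (inv.dualSelmerStructure ((W.baseChange K).torsionGaloisModule ((p ^ 1 : ℕ) : ℤ))
      (str true)).selmerGroup = Nat.card (str false).selmerGroup := by
    refine card_dualSelmerGroup_eq_of_weilTransport (W.baseChange K) (p ^ 1) e hμ hadd₁ hadd₂ hgal hnondeg inv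
      (str true) (str false) (fun v b hb ↦ ?_) (fun v a ha ↦ ?_)
    · by_cases hv : v = Sum.inr w
      · subst hv
        rw [hrelax, dualLocalCondition_top_eq_bot ((W.baseChange K).torsionGaloisModule ((p ^ 1 : ℕ) : ℤ)) inv hperf
          hM w] at hb
        have hb0 : b = 0 := (AddSubgroup.mem_bot).mp hb
        subst hb0
        exact (map_zero (galoisCohomology.map ((weilDualInv (W.baseChange K) (p ^ 1) e hμ hadd₁ hadd₂ hgal
          hnondeg).restrictField (Place.Completion (Sum.inr w : Place K))) 1)).symm ▸ AddSubgroup.zero_mem _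
      · rw [← heq v hv] at hb
        exact map_weilDualInv_mem_of_mem_dual_of_lagrangian (W.baseChange K) (p ^ 1) e hμ hadd₁ hadd₂ hgal hnondeg
          inv v _ (hmax v hv) hb
    · by_cases hv : v = Sum.inr w
      · subst hv
        rw [hstrict] at ha
        have ha0 : a = 0 := (AddSubgroup.mem_bot).mp ha
        subst ha0
        exact (map_zero (galoisCohomology.map ((weilDualIntertwining (W.baseChange K) (p ^ 1) e hμ hadd₁ hadd₂
          hgal).restrictField (Place.Completion (Sum.inr w : Place K))) 1)).symm ▸ AddSubgroup.zero_mem _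
      · rw [← heq v hv]
        exact map_weilDual_mem_dual_of_lagrangian (W.baseChange K) (p ^ 1) e hμ hadd₁ hadd₂ hgal inv v _
          (hmax v hv) ha
  -- `[relaxed : strict]² = #H¹(K_w, E[p]) = (#E(K_w)[p] · #(𝓞_w ⧸ p))² > 1` at `w ∣ p`
  have hidx := relIndex_sq_eq_of_selfdual T' inv hperf hsum hcompl hM hS (hunr false) (hunr true) ⟨w, hwT'⟩ heq
    hstrict hrelax hfin hFd hGd
  have hEuler : Nat.card (galoisCohomology (((W.baseChange K).torsionGaloisModule ((p ^ 1 : ℕ) : ℤ)).toLocal (Sum.inr w)) 1) =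
      (Nat.card (nsmulAddMonoidHom (p ^ 1) :
          ((W.baseChange K).baseChange (w.adicCompletion K)).toAffine.Point →+ _).ker *
        Nat.card (w.adicCompletionIntegers K ⧸
          Ideal.span {((p ^ 1 : ℕ) : w.adicCompletionIntegers K)})) ^ 2 := by
    haveI : CharZero (w.adicCompletion K) := charZero_of_injective_algebraMap (algebraMap K _).injective
    exact natCard_galoisCohomology_one_torsion_adicCompletion_eq_sq (W.baseChange K) w (p ^ 1) hp1 (hEP w)
  haveI := KummerPT.finite_galoisCohomology_toLocal_inr (W.baseChange K) (p ^ 1) w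
  have hH1pos : 0 < Nat.card (galoisCohomology (((W.baseChange K).torsionGaloisModule ((p ^ 1 : ℕ) : ℤ)).toLocal
      (Sum.inr w)) 1) := Nat.card_pos
  have hquot := one_lt_natCard_quotient_span_of_mem K p w hpw
  have hne1 : (str false).selmerGroup.relIndex (str true).selmerGroup ≠ 1 := by
    intro h1
    rw [h1, one_pow] at hidx
    -- `#H¹ = 1` contradicts `#H¹ = (a · b)²` with `a ≥ 1`, `b > 1`
    rw [← hidx] at hEuler hH1pos
    set a := Nat.card (nsmulAddMonoidHom (p ^ 1) :
        ((W.baseChange K).baseChange (w.adicCompletion K)).toAffine.Point →+ _).ker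
    set b := Nat.card (w.adicCompletionIntegers K ⧸
        Ideal.span {((p ^ 1 : ℕ) : w.adicCompletionIntegers K)})
    have hab : a * b = 1 := by
      have h : (a * b) ^ 2 = 1 ^ 2 := by rw [one_pow]; exact hEuler.symm
      exact (Nat.pow_left_injective two_ne_zero) h
    exact absurd (Nat.eq_one_of_mul_eq_one_left hab) (ne_of_gt hquot)
  -- a relaxed class outside the strict group
  obtain ⟨g, hgG, hgF⟩ : ∃ g ∈ (str true).selmerGroup, g ∉ (str false).selmerGroup := by
    by_contra hall
    push Not at hall
    exact hne1 (AddSubgroup.relIndex_eq_one.mpr hall)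
  rw [SelmerStructure.mem_selmerGroup_iff] at hgG
  refine ⟨g, fun u ↦ ?_, fun v hv ↦ ⟨fun hvn ↦ ?_, fun q hq hqv ↦ ?_⟩, fun hgw ↦ hgF ?_⟩
  · exact (mem_selmerLocalKer_iff_localization_mem_kummer_inf_P W K p u g).mpr (by
      have h := hgG (Sum.inl u)
      rw [hstr_inl true u, h𝓚, WeierstrassCurve.kummerSelmerStructure_apply] at h
      exact h)
  · exact (mem_selmerLocalKer_iff_localization_mem_kummer_P W K p v g).mpr (by
      have h := hgG (Sum.inr v)
      rw [hstr_K true v hv (fun ⟨q, hq, hqv⟩ ↦ hvn q hq hqv), h𝓚, WeierstrassCurve.kummerSelmerStructure_apply] at h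
      exact h)
  · have h := hgG (Sum.inr v)
    rw [hstr_n true v hv q hq hqv] at h
    exact mem_toricLocalKer_of_res_mem_toricLocalCondition (W.baseChange K) (p ^ 1) (v.adicCompletion K) h
  · -- if `loc_w g = 0` then `g` satisfies the strict structure everywhere
    rw [SelmerStructure.mem_selmerGroup_iff]
    intro v
    by_cases hv : v = Sum.inr w
    · subst hv
      rw [hstrict]
      have h0 : galoisCohomology.localization ((W.baseChange K).torsionGaloisModule ((p ^ 1 : ℕ) : ℤ))
          (Sum.inr w) 1 g = 0 := by
        have := hgw
        rw [← ker_localization_eq_torsionLocalKer_P W K p w] at this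
        exact this
      rw [h0]
      exact AddSubgroup.zero_mem _
    · rw [heq v hv]
      exact hgG v

end Summit.BirchSwinnertonDyer.BirchSwinnertonDyer.Theorems.AdditiveKoly

end
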